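import Literature.Algebra.Lie.EnvelopingSymbol
import Literature.RingTheory.MvPolynomial.BlockSymmetric
import Literature.NumberTheory.Automorphic.HighestWeightGL
import Literature.Algebra.Lie.ChevalleyRestrictionGL
import Mathlib.LinearAlgebra.Matrix.Trace
import HarnessLib

/-!
# Harish-Chandra's isomorphism for `𝔤_ℂ = ∏_{τ ∈ T} 𝔤𝔩ₙ(ℂ)` (the complex core)

Let `T` be a finite type, `𝔤 = 𝔤 T n = T → Matrix (Fin n) (Fin n) ℂ` (a product of copies of
`𝔤𝔩ₙ(ℂ)`, with the commutator bracket), `U = U(𝔤)` its complex universal enveloping algebra and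
`Z = Z(U)` its centre. This file proves the *complex core* of Harish-Chandra's theorem for `𝔤`
in the following characterisation form, which is what the real-form statement
`Literature.NumberTheory.Automorphic.harishChandraHomGL_bijective_symmetric` (file `HarishChandraGL`) needs:

* `HCCore.HasHWProperty c γ'` — an algebra map `γ' : Z →ₐ[ℂ] ℂ[x_{τ,i}]` has the *highest weight
  property with shift `c`* if every `z ∈ Z` acts on every highest weight vector of weight `λ`
  (`IsHighestWeightVectorC`, file `HighestWeightGL`) of every representation of `𝔤` by the
  scalar `γ'(z)(λ + c)`.
* `HCCore.injective_and_range_eq_of_hasHWProperty` — **main theorem**: if `γ'` has the highest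
  weight property (for some shift `c`) and takes `∏_τ 𝔖ₙ`-symmetric values
  (`blockSymmetricSubalgebra`, file `BlockSymmetric`), then `γ'` is injective and its range is
  exactly the algebra of `∏_τ 𝔖ₙ`-symmetric polynomials.

## Proof architecture

1. *PBW in the order `𝔫⁻ 𝔥 𝔫⁺`* (`idxLinearOrder`, `stdB`, `Literature.Algebra.Lie.PBW.pbwBasis`): every `u ∈ U`
   is uniquely `∑ c_s · (ordered monomial s)`; the **Harish-Chandra projection**
   `hcProj : U →ₗ ℂ[x_{τ,i}]` keeps the purely diagonal monomials (`restrictDiag ∘ symbAll`).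
2. *Action on highest weight vectors* (`lift_ordMonomial_hw`, `lift_center_hw`): an ordered
   monomial containing an `𝔫⁺`-factor kills a highest weight vector `v`; one with an `𝔫⁻`-factor
   but no `𝔫⁺`-factor has non-zero torus weight, so it does not occur in a central element
   (`torusWt_eq_zero_of_repr_center`, via `adU` and the symbol calculus of `EnvelopingSymbol`);
   hence `z · v = (hcProj z)(λ) v` for `z ∈ Z` (Knapp 2002, Prop. 5.34(b); Humphreys §23.2).
3. *Characterisation* (`eq_shiftPoly_hcProj`): a `γ'` with the highest weight property agrees
   with `(hcProj z)(x - c)` at all points `λ + c`, `λ` polynomial dominant (highest weight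
   vectors of these weights exist by `HighestWeightGL.exists_isHighestWeightVectorC_of_antitone`),
   hence everywhere (Zariski density, `HighestWeightGL.eq_of_forall_eval_antitone_eq`).
4. *Injectivity* (`hcProj_injective_on_center`): if `z ∈ Z` and `hcProj z = 0`, then the top
   symbol `σ_k(z) ∈ S(𝔤)` is `ad`-invariant (`adS_symb_eq_zero_of_commute`) with vanishing
   restriction to the diagonal, hence zero by Chevalley's restriction theorem for `𝔤`
   (`ChevalleyRestrictionGL.eq_zero_of_coadDer_eq_zero_of_restrictDiag_eq_zero`); induction on
   the PBW degree `k` (Humphreys §23.2–23.3, Knapp–Vogan Thm. 4.95).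
5. *Surjectivity onto the symmetric polynomials* (`exists_eq_gamma_of_mem`): the Casimir
   elements `C_{τ,k} = tr(𝔼_τ^k)` (`casimir`, central by `casimir_mem_center`) have
   `hcProj (C_{τ,k}) = p_k(x_{τ,·}) + (lower degree)`; block power sums generate the symmetric
   polynomials (`BlockSymmetric.range_blockPsumAeval`, Newton's identities), and an induction on
   the total degree (the values of `γ'` being symmetric by hypothesis, lower-order corrections stay
   in the symmetric algebra) shows every symmetric polynomial is a value of `γ'`
   (Knapp 2002, Thm. 5.44, surjectivity step; Humphreys §23.3).

## References

* A. W. Knapp, *Lie Groups Beyond an Introduction*, 2nd ed., Birkhäuser 2002, §V.4–V.5,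
  Prop. 5.34, Thm. 5.44.
* A. W. Knapp, D. A. Vogan, *Cohomological Induction and Unitary Representations*, Princeton 1995,
  §IV.7, Thm. 4.95.
* J. E. Humphreys, *Introduction to Lie Algebras and Representation Theory*, GTM 9, Springer 1972,
  §17.3–17.4, §23.1–23.3.
* N. Bourbaki, *Lie Groups and Lie Algebras, Chapters 7–9*, Ch. VIII §8.5.
-/

noncomputable section

-- Mathlib idiom: commutator brackets on associative algebras
attribute [local instance 100] LieRing.ofAssociativeRing

open MvPolynomial UniversalEnvelopingAlgebra Literature.Algebra.Lie.PBW Literature.Algebra.Lie.ChevalleyGL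

namespace Literature.NumberTheory.Automorphic.HCCore

variable (T : Type*) [Fintype T] [DecidableEq T] (n : ℕ)

/-! ### The index type with the PBW order `𝔫⁻ < 𝔥 < 𝔫⁺` and the standard basis -/

variable {T n} in
omit [Fintype T] [DecidableEq T] in
/-- The class of an index: `0` strictly lower (`𝔫⁻`), `1` diagonal (`𝔥`), `2` strictly upper (`𝔫⁺`).
[folklore] -/
def idxCls (l : Idx T n) : ℕ :=
  if l.2.2 < l.2.1 then 0 else if l.2.1 = l.2.2 then 1 else 2

variable {T n} in
/-- The sort key: class first, then an arbitrary enumeration. [folklore] -/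
def idxKey (l : Idx T n) : Lex (ℕ × ℕ) :=
  toLex (idxCls l, (Fintype.equivFin (Idx T n) l : ℕ))

variable {T n} in
omit [DecidableEq T] in
/-- The sort key is injective. [folklore] -/
theorem idxKey_injective : Function.Injective (idxKey (T := T) (n := n)) := by
  intro l l' h
  have h2 := congrArg (fun p ↦ (ofLex p).2) h
  simp only [idxKey, ofLex_toLex] at h2
  exact (Fintype.equivFin (Idx T n)).injective (Fin.ext h2)

/-- **The PBW order on the indices** `T × Fin n × Fin n` of the standard basis: `𝔫⁻ < 𝔥 < 𝔫⁺`
(ties broken by an arbitrary enumeration). Mathlib puts no linear order on product types (only the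
pointwise partial order), and the PBW basis of `Literature/Algebra/Lie/PoincareBirkhoffWitt`
takes the order on the index type as an instance; we therefore register this order as a
*local* instance, for this file only. [folklore] -/
@[reducible]
def idxLinearOrder : LinearOrder (Idx T n) :=
  { LinearOrder.lift' idxKey idxKey_injective with
    toDecidableEq := inferInstance
    compare_eq_compareOfLessAndEq := fun a b ↦ by
      convert (LinearOrder.lift' idxKey idxKey_injective).compare_eq_compareOfLessAndEq a b }

attribute [local instance] idxLinearOrder

variable {T n} in
/-- The PBW order refines the class order `𝔫⁻ < 𝔥 < 𝔫⁺`. [folklore] -/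
theorem idxCls_le_of_le {l l' : Idx T n} (h : l ≤ l') : idxCls l ≤ idxCls l' := by
  have h' : idxKey l ≤ idxKey l' := h
  rw [idxKey, idxKey, Prod.Lex.toLex_le_toLex] at h'
  rcases h' with h' | ⟨h', -⟩
  · exact h'.le
  · exact h'.le

variable {T n} in
/-- An upper index: `a < b`. [folklore] -/
def IsUpper (l : Idx T n) : Prop := l.2.1 < l.2.2

variable {T n} in
/-- A diagonal index: `a = b`. [folklore] -/
def IsDiag (l : Idx T n) : Prop := l.2.1 = l.2.2

variable {T n} in
omit [Fintype T] [DecidableEq T] in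
/-- Class `2` is the strictly upper triangular part `𝔫⁺`. [folklore] -/
theorem idxCls_eq_two_iff {l : Idx T n} : idxCls l = 2 ↔ IsUpper l := by
  unfold idxCls IsUpper
  split_ifs with h1 h2
  · simp only [false_iff, not_lt]
    exact h1.le
  · simp only [OfNat.one_ne_ofNat, false_iff, not_lt, h2, le_refl]
  · simp only [true_iff]
    exact lt_of_le_of_ne (not_lt.mp h1) h2

variable {T n} in
omit [Fintype T] [DecidableEq T] in
/-- There are three classes. [folklore] -/
theorem idxCls_le_two (l : Idx T n) : idxCls l ≤ 2 := by
  unfold idxCls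
  split_ifs <;> omega

variable {T n} in
/-- The upper indices form an upper set for the PBW order. [folklore] -/
theorem IsUpper.of_le {l l' : Idx T n} (hl : IsUpper l) (h : l ≤ l') : IsUpper l' := by
  rw [← idxCls_eq_two_iff] at hl ⊢
  have := idxCls_le_of_le h
  have := idxCls_le_two l'
  omega

/-- The Lie algebra `𝔤 = 𝔤𝔩ₙ(ℂ)^T` (commutator bracket). [folklore] -/
abbrev 𝔤 : Type _ := T → Matrix (Fin n) (Fin n) ℂ

/-- Coordinates: `𝔤 ≃ₗ (Idx → ℂ)`, `X ↦ ((τ,a,b) ↦ X τ a b)`. [folklore] -/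
def coordEquiv : 𝔤 T n ≃ₗ[ℂ] (Idx T n → ℂ) where
  toFun X := fun l ↦ X l.1 l.2.1 l.2.2
  invFun f := fun τ ↦ Matrix.of fun a b ↦ f (τ, a, b)
  map_add' _ _ := rfl
  map_smul' _ _ := rfl
  left_inv _ := rfl
  right_inv _ := rfl

/-- The standard basis `E^τ_{ab}` of `𝔤𝔩ₙ(ℂ)^T`, with `repr X (τ,a,b) = X τ a b`. [folklore] -/
def stdB : Module.Basis (Idx T n) ℂ (𝔤 T n) :=
  Module.Basis.ofEquivFun (coordEquiv T n)

variable {T n}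

omit [DecidableEq T] in
/-- Coordinates in the standard basis are the matrix entries. [folklore] -/
@[simp]
theorem stdB_repr (X : 𝔤 T n) (l : Idx T n) : (stdB T n).repr X l = X l.1 l.2.1 l.2.2 := rfl

/-- Entries of the standard basis matrices `E^τ_{ab}`. [folklore] -/
theorem stdB_apply_apply (l : Idx T n) (τ : T) (a b : Fin n) :
    stdB T n l τ a b = if l = (τ, a, b) then 1 else 0 := by
  rw [stdB, Module.Basis.coe_ofEquivFun]
  show (Pi.single l (1 : ℂ) : Idx T n → ℂ) (τ, a, b) = _
  rw [Pi.single_apply]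
  by_cases h : l = (τ, a, b)
  · rw [if_pos h, if_pos h.symm]
  · rw [if_neg h, if_neg (Ne.symm h)]

/-- `E_l` in block `τ'` is the elementary matrix if `l.1 = τ'` and zero otherwise. [folklore] -/
theorem stdB_apply (l : Idx T n) (τ : T) :
    stdB T n l τ = if l.1 = τ then Matrix.single l.2.1 l.2.2 (1 : ℂ) else 0 := by
  ext a b
  rw [stdB_apply_apply]
  obtain ⟨τ', c, d⟩ := l
  dsimp only
  by_cases h : τ' = τ
  · subst h
    rw [if_pos rfl, Matrix.single_apply]
    by_cases hab : c = a ∧ d = b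
    · obtain ⟨rfl, rfl⟩ := hab
      rw [if_pos rfl, if_pos ⟨rfl, rfl⟩]
    · rw [if_neg hab, if_neg]
      intro h'
      have h2 := congrArg (fun p : Idx T n ↦ (p.2.1, p.2.2)) h'
      simp only [Prod.mk.injEq] at h2
      exact hab ⟨h2.1, h2.2⟩
  · rw [if_neg h, Matrix.zero_apply, if_neg]
    rintro ⟨rfl, -⟩
    exact h rfl

/-- **Brackets of elementary matrices**: `[E^τ_{cd}, E^{τ'}_{ab}] = [τ=τ'] (δ_{da} E^τ_{cb} - δ_{bc} E^τ_{ad})`.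
[folklore] -/
theorem lie_stdB (τ τ' : T) (c d a b : Fin n) :
    ⁅stdB T n (τ, c, d), stdB T n (τ', a, b)⁆ = if τ = τ' then
      ((if d = a then stdB T n (τ, c, b) else 0) - (if b = c then stdB T n (τ, a, d) else 0)) else 0 := by
  funext τ''
  rw [LieRing.of_associative_ring_bracket, Pi.sub_apply, Pi.mul_apply, Pi.mul_apply, stdB_apply, stdB_apply]
  dsimp only
  have hprod : Matrix.single c d (1 : ℂ) * Matrix.single a b 1 - Matrix.single a b 1 * Matrix.single c d 1 =
      (if d = a then Matrix.single c b 1 else 0) - (if b = c then Matrix.single a d 1 else 0) := by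
    congr 1
    · by_cases h : d = a
      · subst h; rw [if_pos rfl, Matrix.single_mul_single_same, mul_one]
      · rw [if_neg h, Matrix.single_mul_single_of_ne (h := h)]
    · by_cases h : b = c
      · subst h; rw [if_pos rfl, Matrix.single_mul_single_same, mul_one]
      · rw [if_neg h, Matrix.single_mul_single_of_ne (h := h)]
  by_cases h1 : τ = τ''
  · subst h1
    by_cases h2 : τ' = τ
    · subst h2
      rw [if_pos rfl, if_pos rfl, if_pos rfl, hprod]
      congr 1 <;> split_ifs <;> simp [stdB_apply]
    · rw [if_pos rfl, if_neg h2, if_neg (Ne.symm h2), Matrix.mul_zero, Matrix.zero_mul, sub_zero,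
        Pi.zero_apply]
  · rw [if_neg h1, Matrix.mul_zero, Matrix.zero_mul, sub_zero]
    split_ifs with h2 <;> simp [stdB_apply, h1]

/-- Bracket with a diagonal basis element: `[E^τ_{cc}, E_l] = ([l.1=τ]([c=a]-[c=b])) • E_l`,
the eigenvalue being the torus weight of `l`. [folklore] -/
theorem lie_stdB_diag (τ : T) (c : Fin n) (l : Idx T n) :
    ⁅stdB T n (τ, c, c), stdB T n l⁆ =
      (((if l.1 = τ then ((if c = l.2.1 then 1 else 0) - (if c = l.2.2 then 1 else 0)) else 0 : ℤ) : ℂ)) •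
        stdB T n l := by
  obtain ⟨τ', a, b⟩ := l
  rw [lie_stdB]
  dsimp only
  by_cases h : τ = τ'
  · subst h
    rw [if_pos rfl, if_pos rfl]
    by_cases hca : c = a <;> by_cases hcb : c = b
    · subst hca; subst hcb; simp
    · subst hca; simp [Ne.symm hcb, hcb]
    · subst hcb; simp [hca]
    · simp [Ne.symm hcb, hca, hcb]
  · rw [if_neg h, if_neg (Ne.symm h)]
    simp


/-! ### Highest weight vectors and ordered monomials -/

section HW

local notation "𝔘" => UniversalEnvelopingAlgebra ℂ (𝔤 T n)

variable {V : Type*} [AddCommGroup V] [Module ℂ V] {ρ : 𝔤 T n →ₗ⁅ℂ⁆ Module.End ℂ V}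
  {l : T → Fin n → ℂ} {v : V}

/-- Strictly upper basis elements kill a highest weight vector. [folklore] -/
theorem hw_apply_stdB_upper (hv : IsHighestWeightVectorC ρ l v) {i : Idx T n} (hi : IsUpper i) :
    ρ (stdB T n i) v = 0 := by
  refine hv.2.1 _ fun τ a c hca ↦ ?_
  rw [stdB_apply_apply, if_neg]
  rintro rfl
  exact absurd hi (not_lt.mpr hca)

/-- Diagonal basis elements act on a highest weight vector by the weight. [folklore] -/
theorem hw_apply_stdB_diag (hv : IsHighestWeightVectorC ρ l v) (τ : T) (a : Fin n) :
    ρ (stdB T n (τ, a, a)) v = l τ a • v := by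
  have h := hv.2.2 fun τ' c ↦ if τ' = τ ∧ c = a then 1 else 0
  have e : (fun τ' ↦ Matrix.diagonal ((fun τ' c ↦ if τ' = τ ∧ c = a then (1 : ℂ) else 0) τ')) =
      stdB T n (τ, a, a) := by
    funext τ'
    ext c d
    simp only [Matrix.diagonal_apply, stdB_apply_apply]
    by_cases h1 : τ = τ' <;> by_cases h2 : a = c <;> by_cases h3 : c = d <;>
      simp [h1, h2, h3, Prod.mk.injEq, eq_comm]
  rw [e] at h
  rw [h]
  congr 1
  rw [Finset.sum_eq_single τ, Finset.sum_eq_single a]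
  · simp
  · intro c _ hc
    rw [if_neg (fun h ↦ hc h.2), mul_zero]
  · simp
  · intro τ' _ hτ'
    exact Finset.sum_eq_zero fun c _ ↦ by rw [if_neg (fun h ↦ hτ' h.1), mul_zero]
  · simp

/-- **Ordered monomials in `𝔥` act on a highest weight vector by evaluation of the monomial at
the weight.** [cite: Humphreys1972, §20.2 and §23.2] -/
theorem lift_ordMonomial_smul_of_diag (hv : IsHighestWeightVectorC ρ l v) (s : Idx T n →₀ ℕ)
    (hs : ∀ i ∈ s.support, IsDiag i) :
    lift ℂ ρ (ordMonomial (stdB T n) s) v = (s.prod fun i k ↦ l i.1 i.2.1 ^ k) • v := by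
  induction s using Literature.Algebra.Lie.PBW.induction_on_min with
  | h0 => simp [ordMonomial_zero]
  | hadd j t hjt ih =>
    have hj : IsDiag j := hs j (by simp [support_single_one_add])
    have ht : ∀ i ∈ t.support, IsDiag i := fun i hi ↦ hs i (by simp [support_single_one_add, hi])
    obtain ⟨τ, a, c⟩ := j
    have hj' : a = c := hj
    subst hj'
    rw [ordMonomial_single_add _ hjt, map_mul, lift_ι_apply, Module.End.mul_apply, ih ht, map_smul,
      hw_apply_stdB_diag hv, smul_smul, Finsupp.prod_add_index' (fun _ ↦ pow_zero _)
        (fun _ _ _ ↦ pow_add _ _ _),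
      Finsupp.prod_single_index (h := fun (i : Idx T n) (k : ℕ) ↦ l i.1 i.2.1 ^ k) (pow_zero _),
      pow_one, mul_comm]

/-- **Ordered monomials containing an element of `𝔫⁺` kill a highest weight vector**
(in the PBW order `𝔫⁻ < 𝔥 < 𝔫⁺` the `𝔫⁺` factors stand rightmost).
[cite: Humphreys1972, §23.2; Knapp–Vogan 1995 Prop. 4.89] -/
theorem lift_ordMonomial_eq_zero_of_upper (hv : IsHighestWeightVectorC ρ l v) (s : Idx T n →₀ ℕ)
    (hs : ∃ i ∈ s.support, IsUpper i) : lift ℂ ρ (ordMonomial (stdB T n) s) v = 0 := by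
  induction s using Literature.Algebra.Lie.PBW.induction_on_min with
  | h0 =>
    obtain ⟨i, hi, -⟩ := hs
    simp at hi
  | hadd j t hjt ih =>
    rw [ordMonomial_single_add _ hjt, map_mul, lift_ι_apply, Module.End.mul_apply]
    by_cases ht : ∃ i ∈ t.support, IsUpper i
    · rw [ih ht, map_zero]
    · push Not at ht
      obtain ⟨i, hi, hiu⟩ := hs
      rw [support_single_one_add, Finset.mem_insert] at hi
      have hju : IsUpper j := by
        rcases hi with rfl | hi
        · exact hiu
        · exact absurd hiu (ht i hi)
      have ht0 : t = 0 := by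
        by_contra h0
        obtain ⟨i', hi'⟩ := Finsupp.support_nonempty_iff.mpr h0
        exact ht i' hi' (hju.of_le (hjt i' hi'))
      subst ht0
      rw [ordMonomial_zero, map_one, Module.End.one_apply, hw_apply_stdB_upper hv hju]

end HW

/-! ### Torus weights of PBW monomials; central elements have weight zero -/

section Torus

local notation "𝔘" => UniversalEnvelopingAlgebra ℂ (𝔤 T n)

open Literature.Algebra.Lie.ChevalleyGL in
/-- **PBW monomials are weight vectors for `ad 𝔥`**: `ad(E^τ_{cc})(x_s) = wt_{τ,c}(s) x_s` with the
integer torus weight of `ChevalleyRestrictionGL`. [cite: Humphreys1972, §23.2] -/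
theorem adU_ordMonomial_diag (τ : T) (c : Fin n) (s : Idx T n →₀ ℕ) :
    adU (R := ℂ) (stdB T n (τ, c, c)) (ordMonomial (stdB T n) s) =
      ((torusWt τ c s : ℤ) : ℂ) • ordMonomial (stdB T n) s := by
  induction s using Literature.Algebra.Lie.PBW.induction_on_min with
  | h0 =>
    have h0 : torusWt τ c (0 : Idx T n →₀ ℕ) = 0 := by simp [torusWt]
    rw [ordMonomial_zero, adU_apply, mul_one, one_mul, sub_self, h0, Int.cast_zero, zero_smul]
  | hadd j t hjt ih =>
    rw [ordMonomial_single_add _ hjt, adU_ι_mul, ih, lie_stdB_diag, map_smul, smul_mul_assoc,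
      mul_smul_comm, ← add_smul, torusWt_add, torusWt_single, Nat.cast_one, one_mul, Int.cast_add]

open Literature.Algebra.Lie.ChevalleyGL in
/-- **Central elements have `ad 𝔥`-weight zero**: every PBW monomial occurring in a central
element has all torus weights `0`. [cite: Humphreys1972, §23.2; Knapp–Vogan 1995 Prop. 4.89(b)] -/
theorem torusWt_eq_zero_of_mem_center {z : 𝔘} (hz : z ∈ Subalgebra.center ℂ 𝔘)
    {s : Idx T n →₀ ℕ} (hs : s ∈ ((pbwBasis (stdB T n)).repr z).support) (τ : T) (c : Fin n) :
    torusWt τ c s = 0 := by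
  have h1 : adU (R := ℂ) (stdB T n (τ, c, c)) z = 0 := by
    rw [adU_apply, Subalgebra.mem_center_iff.mp hz, sub_self]
  have hz' : z = ∑ s ∈ ((pbwBasis (stdB T n)).repr z).support,
      (pbwBasis (stdB T n)).repr z s • ordMonomial (stdB T n) s := by
    conv_lhs => rw [← (pbwBasis (stdB T n)).linearCombination_repr z, Finsupp.linearCombination_apply]
    simp only [pbwBasis_apply]
    rfl
  rw [hz', map_sum, Finset.sum_congr rfl fun s' _ ↦ by
    rw [(adU (R := ℂ) (stdB T n (τ, c, c))).map_smul, adU_ordMonomial_diag, smul_smul]] at h1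
  have h2 := linearIndependent_iff'.mp (linearIndependent_ordMonomial (stdB T n)) _ _ h1 s hs
  have h3 : ((torusWt τ c s : ℤ) : ℂ) = 0 :=
    (mul_eq_zero.mp h2).resolve_left (Finsupp.mem_support_iff.mp hs)
  exact_mod_cast h3

open Literature.Algebra.Lie.ChevalleyGL in
omit [Fintype T] in
/-- Pairing the torus weights against `ρ^∨ = ∑_c c E^τ_{cc}`:
`∑_τ ∑_c c · wt_{τ,c}(s) = ∑_i s_i (a_i - b_i)`. [folklore] -/
theorem sum_mul_torusWt [Fintype T] (s : Idx T n →₀ ℕ) :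
    ∑ τ : T, ∑ c : Fin n, (c : ℤ) * torusWt τ c s = s.sum fun i k ↦ (k : ℤ) * ((i.2.1 : ℤ) - i.2.2) := by
  induction s using Finsupp.induction with
  | zero =>
    rw [Finsupp.sum_zero_index]
    refine Finset.sum_eq_zero fun τ _ ↦ Finset.sum_eq_zero fun c _ ↦ ?_
    have h0 : torusWt τ c (0 : Idx T n →₀ ℕ) = 0 := by simp [torusWt]
    rw [h0, mul_zero]
  | single_add j k s hj hk ih =>
    rw [Finsupp.sum_add_index' (fun _ ↦ by simp) (fun _ _ _ ↦ by push_cast; ring), ← ih,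
      Finsupp.sum_single_index (by simp)]
    simp_rw [torusWt_add, mul_add, Finset.sum_add_distrib]
    congr 1
    simp_rw [torusWt_single]
    rw [Finset.sum_eq_single j.1 (fun τ _ hτ ↦ Finset.sum_eq_zero fun c _ ↦ by
      rw [if_neg (Ne.symm hτ), mul_zero, mul_zero]) (by simp)]
    rw [Finset.sum_congr rfl fun x _ ↦ by rw [if_pos rfl]]
    have e1 : ∀ b : Fin n, ∑ x : Fin n, (x : ℤ) * ((k : ℤ) * (if x = b then 1 else 0)) = k * b := by
      intro b
      rw [Finset.sum_eq_single b (fun x _ hx ↦ by rw [if_neg hx, mul_zero, mul_zero]) (by simp)]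
      rw [if_pos rfl, mul_one, mul_comm]
    simp only [mul_sub, Finset.sum_sub_distrib, e1]

open Literature.Algebra.Lie.ChevalleyGL in
omit [Fintype T] in
/-- A multi-index all of whose torus weights vanish and which contains no `𝔫⁺` index is supported
on `𝔥`. [cite: Humphreys1972, §23.2] -/
theorem isDiag_of_torusWt_eq_zero [Fintype T] {s : Idx T n →₀ ℕ} (hwt : ∀ τ c, torusWt τ c s = 0)
    (hup : ∀ i ∈ s.support, ¬IsUpper i) : ∀ i ∈ s.support, IsDiag i := by
  have key : (s.sum fun i k ↦ (k : ℤ) * ((i.2.1 : ℤ) - i.2.2)) = 0 := by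
    rw [← sum_mul_torusWt]
    exact Finset.sum_eq_zero fun τ _ ↦ Finset.sum_eq_zero fun c _ ↦ by rw [hwt, mul_zero]
  rw [Finsupp.sum, Finset.sum_eq_zero_iff_of_nonneg] at key
  · intro i hi
    have h1 := key i hi
    have h2 : (s i : ℤ) ≠ 0 := by exact_mod_cast Finsupp.mem_support_iff.mp hi
    have h3 := (mul_eq_zero.mp h1).resolve_left h2
    unfold IsDiag
    ext
    omega
  · intro i hi
    have h := hup i hi
    unfold IsUpper at h
    have : (i.2.2 : ℤ) ≤ i.2.1 := by exact_mod_cast not_lt.mp h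
    exact mul_nonneg (by positivity) (by omega)

end Torus

/-! ### The Harish-Chandra projection and the action of the centre on highest weight vectors -/

section Projection

local notation "𝔘" => UniversalEnvelopingAlgebra ℂ (𝔤 T n)

variable {V : Type*} [AddCommGroup V] [Module ℂ V] {ρ : 𝔤 T n →ₗ⁅ℂ⁆ Module.End ℂ V}
  {l : T → Fin n → ℂ} {v : V}

variable (l) in
/-- The weight `λ` as a point of `𝔤^*` supported on the diagonal: `z_{τ,a,b} ↦ [a=b] λ_{τ,a}`. [folklore] -/
def diagPt : Idx T n → ℂ := fun i ↦ if i.2.1 = i.2.2 then l i.1 i.2.1 else 0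

omit [DecidableEq T] in
omit [Fintype T] in
/-- A monomial supported on `𝔥`, evaluated at the diagonal point, is the product of the weights.
[folklore] -/
theorem eval_diagPt_monomial_of_diag {s : Idx T n →₀ ℕ} (h : ∀ i ∈ s.support, IsDiag i) :
    eval (diagPt l) (monomial s 1) = s.prod fun i k ↦ l i.1 i.2.1 ^ k := by
  rw [eval_monomial, one_mul]
  refine Finset.prod_congr rfl fun i hi ↦ ?_
  have h' : i.2.1 = i.2.2 := h i hi
  simp only [diagPt, h', if_true]

omit [DecidableEq T] in
omit [Fintype T] in
/-- A monomial meeting `𝔫⁻ ∪ 𝔫⁺` vanishes at the diagonal point. [folklore] -/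
theorem eval_diagPt_monomial_eq_zero {s : Idx T n →₀ ℕ} {i : Idx T n} (hi : i ∈ s.support)
    (hid : ¬IsDiag i) : eval (diagPt l) (monomial s 1) = 0 := by
  rw [eval_monomial, one_mul]
  refine Finset.prod_eq_zero hi ?_
  have h' : ¬i.2.1 = i.2.2 := hid
  simp only [diagPt, h', if_false, zero_pow (Finsupp.mem_support_iff.mp hi)]

/-- **Ordered monomials occurring in a central element act on a highest weight vector by their
value at the weight.** [cite: Humphreys1972, §23.2; Knapp–Vogan 1995 Prop. 4.89 and (4.99)] -/
theorem lift_ordMonomial_hw (hv : IsHighestWeightVectorC ρ l v) {z : 𝔘} (hz : z ∈ Subalgebra.center ℂ 𝔘)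
    {s : Idx T n →₀ ℕ} (hs : s ∈ ((pbwBasis (stdB T n)).repr z).support) :
    lift ℂ ρ (ordMonomial (stdB T n) s) v = eval (diagPt l) (monomial s 1) • v := by
  by_cases hup : ∃ i ∈ s.support, IsUpper i
  · obtain ⟨i, hi, hiu⟩ := hup
    have hid : ¬IsDiag i := fun h ↦ by
      unfold IsUpper at hiu
      unfold IsDiag at h
      rw [h] at hiu
      exact lt_irrefl _ hiu
    rw [lift_ordMonomial_eq_zero_of_upper hv s ⟨i, hi, hiu⟩, eval_diagPt_monomial_eq_zero hi hid,
      zero_smul]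
  · push Not at hup
    have hdiag := isDiag_of_torusWt_eq_zero (fun τ c ↦ torusWt_eq_zero_of_mem_center hz hs τ c) hup
    rw [lift_ordMonomial_smul_of_diag hv s hdiag, eval_diagPt_monomial_of_diag hdiag]

variable (T n) in
/-- **The Harish-Chandra projection** `Z(𝔤) ⊆ U(𝔤) → S(𝔥) = ℂ[x_{τ,i}]`: take the total symbol
(PBW coordinates, `x_s ↦ z_s`) and restrict to the diagonal (kill every monomial meeting
`𝔫⁻ ∪ 𝔫⁺`). On the centre this is Harish-Chandra's `γ'ₙ` (Knapp 2002, before Thm. 5.44) =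
`ξ` (Humphreys §23.2) = the `ℋ`-component of Knapp–Vogan's Prop. 4.89. [cite: Humphreys1972, §23.2] -/
def hcProj : 𝔘 →ₗ[ℂ] MvPolynomial (T × Fin n) ℂ :=
  (restrictDiag T n ℂ).toLinearMap ∘ₗ symbAll (stdB T n)

/-- Unfolding of the Harish-Chandra projection: restriction to the diagonal of the full symbol.
[folklore] -/
theorem hcProj_apply (u : 𝔘) : hcProj T n u = restrictDiag T n ℂ (symbAll (stdB T n) u) := rfl

omit [Fintype T] [DecidableEq T] in
/-- Evaluating the restriction at `λ` is evaluating at the diagonal point `diagPt λ`. [folklore] -/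
theorem eval_restrictDiag_eq_eval_diagPt (P : Coord T n ℂ) :
    eval (fun p ↦ l p.1 p.2) (restrictDiag T n ℂ P) = eval (diagPt l) P := by
  rw [eval_restrictDiag]
  rfl

/-- **The centre acts on highest weight vectors through the Harish-Chandra projection**: for
`z ∈ Z(𝔤𝔩ₙ(ℂ)^T)` and a highest weight vector `v` of weight `λ` (in any module),
`z · v = (hcProj z)(λ) · v`. [cite: Humphreys1972, §23.2 (χ_λ(z) = λ(ξ(z))); Knapp–Vogan 1995 (4.99)] -/
theorem lift_center_hw (hv : IsHighestWeightVectorC ρ l v) {z : 𝔘} (hz : z ∈ Subalgebra.center ℂ 𝔘) :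
    lift ℂ ρ z v = eval (fun p ↦ l p.1 p.2) (hcProj T n z) • v := by
  have hz' : z = ∑ s ∈ ((pbwBasis (stdB T n)).repr z).support,
      (pbwBasis (stdB T n)).repr z s • ordMonomial (stdB T n) s := by
    conv_lhs => rw [← (pbwBasis (stdB T n)).linearCombination_repr z, Finsupp.linearCombination_apply]
    simp only [pbwBasis_apply]
    rfl
  have hsymb : symbAll (stdB T n) z = ∑ s ∈ ((pbwBasis (stdB T n)).repr z).support,
      (pbwBasis (stdB T n)).repr z s • monomial s (1 : ℂ) := by
    conv_lhs => rw [hz', map_sum]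
    refine Finset.sum_congr rfl fun s _ ↦ ?_
    rw [map_smul, symbAll_ordMonomial]
  rw [hcProj_apply, eval_restrictDiag_eq_eval_diagPt, hsymb, map_sum, Finset.sum_smul]
  conv_lhs => rw [hz', map_sum, LinearMap.sum_apply]
  refine Finset.sum_congr rfl fun s hs ↦ ?_
  rw [map_smul, LinearMap.smul_apply, lift_ordMonomial_hw hv hz hs, smul_smul, smul_eval]

end Projection

/-! ### Translations of polynomials -/

section Shift

variable {σ K : Type*} [CommRing K]

/-- The translation `Q ↦ Q(x - c)` of polynomials (an algebra automorphism). [folklore] -/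
def shiftPoly (c : σ → K) : MvPolynomial σ K →ₐ[K] MvPolynomial σ K :=
  aeval fun p ↦ X p - C (c p)

/-- Evaluating the shifted polynomial: `(shiftPoly c Q)(x) = Q(x - c)`. [folklore] -/
theorem eval_shiftPoly (c x : σ → K) (Q : MvPolynomial σ K) :
    eval x (shiftPoly c Q) = eval (fun p ↦ x p - c p) Q := by
  rw [shiftPoly, MvPolynomial.eval, aeval_eq_bind₁, eval₂Hom_bind₁]
  change eval₂Hom _ _ Q = eval₂Hom _ _ Q
  congr 2
  funext p
  simp

/-- Shifting by `c` and then by `-c` is the identity. [folklore] -/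
theorem shiftPoly_neg_shiftPoly (c : σ → K) (Q : MvPolynomial σ K) :
    shiftPoly (-c) (shiftPoly c Q) = Q := by
  suffices h : (shiftPoly (-c)).comp (shiftPoly c) = AlgHom.id K _ from AlgHom.congr_fun h Q
  refine MvPolynomial.algHom_ext fun p ↦ ?_
  simp [shiftPoly]

/-- The shift `Q ↦ Q(x - c)` is injective. [folklore] -/
theorem shiftPoly_injective (c : σ → K) : Function.Injective (shiftPoly c) := fun P Q h ↦ by
  rw [← shiftPoly_neg_shiftPoly c P, ← shiftPoly_neg_shiftPoly c Q, h]

end Shift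

/-! ### A homomorphism with the highest weight property is `shift ∘ hcProj` -/

section Characterisation

local notation "𝔘" => UniversalEnvelopingAlgebra ℂ (𝔤 T n)

/-- The **highest weight property** of an algebra map `γ' : Z(U(𝔤)) → ℂ[x_{τ,i}]` with shift `c`:
every central `z` acts on every highest weight vector of weight `λ` (in every module in `Type`) by
`γ'(z)(λ + c)` (for the Harish-Chandra homomorphism, `c = ρ`). [cite: KnappVogan1995, (4.99)] -/
def HasHWProperty (c : T × Fin n → ℂ)
    (γ' : Subalgebra.center ℂ 𝔘 →ₐ[ℂ] MvPolynomial (T × Fin n) ℂ) : Prop :=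
  ∀ (V : Type) [AddCommGroup V] [Module ℂ V] (ρ : 𝔤 T n →ₗ⁅ℂ⁆ Module.End ℂ V)
    (l : T → Fin n → ℂ) (v : V), IsHighestWeightVectorC ρ l v →
      ∀ z : Subalgebra.center ℂ 𝔘,
        lift ℂ ρ (z : 𝔘) v = MvPolynomial.aeval (fun p : T × Fin n ↦ l p.1 p.2 + c p) (γ' z) • v

/-- **A homomorphism with the highest weight property is the shifted Harish-Chandra projection**:
`γ'(z) = (hcProj z)(x - c)`, because both sides agree at `λ + c` for all dominant integral `λ`
(the highest weights of the minor modules of `HighestWeightGL`), a Zariski dense set.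
[cite: KnappVogan1995, Thm. 4.95 with (4.99); Knapp2002, Thm. 5.44] -/
theorem eq_shiftPoly_hcProj {c : T × Fin n → ℂ}
    {γ' : Subalgebra.center ℂ 𝔘 →ₐ[ℂ] MvPolynomial (T × Fin n) ℂ} (hγ : HasHWProperty c γ')
    (z : Subalgebra.center ℂ 𝔘) : γ' z = shiftPoly c (hcProj T n z) := by
  refine eq_of_forall_eval_antitone_eq c _ _ fun lam hlam ↦ ?_
  obtain ⟨V, _, _, ρ, v, hv⟩ := exists_isHighestWeightVectorC_of_antitone (R := ℂ) lam hlam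
  have h1 := hγ V ρ _ v hv z
  have h2 := lift_center_hw hv z.2
  rw [h1] at h2
  have h3 := smul_left_injective ℂ hv.1 h2
  have e : ∀ Q : MvPolynomial (T × Fin n) ℂ, MvPolynomial.aeval (fun p : T × Fin n ↦ (lam p.1 p.2 : ℂ) + c p) Q =
      eval (fun p : T × Fin n ↦ (lam p.1 p.2 : ℂ) + c p) Q := fun Q ↦ rfl
  rw [e] at h3
  rw [h3, eval_shiftPoly]
  congr 2
  funext p
  simp

end Characterisation

/-! ### Injectivity: top symbols of central elements are invariant and restrict to zero -/

section Injectivity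

local notation "𝔘" => UniversalEnvelopingAlgebra ℂ (𝔤 T n)

/-- The derivation `ad_S(E^τ_{cd})` of `S(𝔤)` induced by the standard basis is the coadjoint
derivation `coadDer τ c d` of `ChevalleyRestrictionGL`. [folklore] -/
theorem adS_stdB (τ : T) (c d : Fin n) : adS (stdB T n) (stdB T n (τ, c, d)) = coadDer τ c d := by
  have hb : ∀ m : Idx T n, Finsupp.linearCombination ℂ (X (R := ℂ)) ((stdB T n).repr (stdB T n m)) = X m :=
    fun m ↦ by rw [Module.Basis.repr_self, Finsupp.linearCombination_single, one_smul]
  refine MvPolynomial.derivation_ext fun ⟨τ', a, b⟩ ↦ ?_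
  rw [adS_X, coadDer_X_apply, lie_stdB]
  by_cases h : τ = τ'
  · subst h
    rw [if_pos rfl, if_pos rfl, map_sub, map_sub]
    congr 1
    · by_cases hda : d = a
      · rw [if_pos hda, if_pos hda, hb]
      · rw [if_neg hda, if_neg hda, map_zero, map_zero]
    · by_cases hcb : c = b
      · rw [if_pos hcb.symm, if_pos hcb, hb]
      · rw [if_neg (Ne.symm hcb), if_neg hcb, map_zero, map_zero]
  · rw [if_neg h, if_neg (Ne.symm h), map_zero, map_zero]

/-- The top symbol of a central element is killed by all coadjoint derivations. [cite: Humphreys1972, §23.3] -/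
theorem coadDer_symb_eq_zero {z : 𝔘} (hz : z ∈ Subalgebra.center ℂ 𝔘) {k : ℕ} (hk : z ∈ fil (stdB T n) k)
    (τ : T) (c d : Fin n) : coadDer τ c d (symb (stdB T n) k z) = 0 := by
  rw [← adS_stdB]
  exact adS_symb_eq_zero_of_commute (stdB T n) _ hk (Subalgebra.mem_center_iff.mp hz _)

omit [Fintype T] [DecidableEq T] in
/-- Restriction to the diagonal commutes with taking homogeneous components (it is induced by a
substitution of variables by variables or `0`). [folklore] -/
theorem homogeneousComponent_restrictDiag (k : ℕ) (Q : Coord T n ℂ) :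
    homogeneousComponent k (restrictDiag T n ℂ Q) = restrictDiag T n ℂ (homogeneousComponent k Q) := by
  have h := Literature.RingTheory.MvPolynomial.BlockSymmetric.homogeneousComponent_aeval (1 : Idx T n → ℕ)
    (fun l : Idx T n ↦ if l.2.1 = l.2.2 then (X (l.1, l.2.1) : MvPolynomial (T × Fin n) ℂ) else 0)
    (fun l ↦ by
      dsimp only [Pi.one_apply]
      split_ifs
      · exact isHomogeneous_X _ _
      · exact isHomogeneous_zero _ _ _) Q k
  exact h

/-- The degree-`k` part of the Harish-Chandra projection is the restriction of the `k`-th symbol.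
[cite: Humphreys1972, §23.3; Bourbaki LIE VIII §8.5 proof of Th. 2, formula (3)] -/
theorem homogeneousComponent_hcProj (k : ℕ) (u : 𝔘) :
    homogeneousComponent k (hcProj T n u) = restrictDiag T n ℂ (symb (stdB T n) k u) := by
  rw [hcProj_apply, homogeneousComponent_restrictDiag, homogeneousComponent_symbAll]

/-- **Injectivity of the Harish-Chandra projection on the centre.** A central element whose
projection vanishes is zero: otherwise its top symbol would be a nonzero `ad`-invariant of `S(𝔤)`
restricting to `0` on the diagonal, contradicting Chevalley restriction
(`ChevalleyRestrictionGL`). [cite: Humphreys1972, §23.3; Bourbaki LIE VIII §8.5 Th. 2 (c)] -/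
theorem eq_zero_of_hcProj_eq_zero {z : 𝔘} (hz : z ∈ Subalgebra.center ℂ 𝔘) (h : hcProj T n z = 0) :
    z = 0 := by
  by_contra hne
  obtain ⟨k, hk, hsymb⟩ := exists_symb_ne_zero (stdB T n) hne
  refine hsymb (eq_zero_of_coadDer_eq_zero_of_restrictDiag_eq_zero _ (coadDer_symb_eq_zero hz hk) ?_)
  rw [← homogeneousComponent_hcProj, h, map_zero]

/-- **Injectivity half of Harish-Chandra's theorem**: an algebra map on the centre with the highest
weight property is injective. [cite: KnappVogan1995, Thm. 4.95; Knapp2002, Thm. 5.44] -/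
theorem injective_of_hasHWProperty {c : T × Fin n → ℂ}
    {γ' : Subalgebra.center ℂ 𝔘 →ₐ[ℂ] MvPolynomial (T × Fin n) ℂ} (hγ : HasHWProperty c γ') :
    Function.Injective γ' := by
  intro z z' hzz'
  rw [eq_shiftPoly_hcProj hγ, eq_shiftPoly_hcProj hγ] at hzz'
  have h1 := shiftPoly_injective c hzz'
  have h2 : hcProj T n ((z : 𝔘) - z') = 0 := by rw [map_sub, h1, sub_self]
  have h3 := eq_zero_of_hcProj_eq_zero (Subalgebra.sub_mem _ z.2 z'.2) h2
  exact Subtype.ext (sub_eq_zero.mp h3)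

end Injectivity

/-! ### Casimir elements: traces of powers of the matrix of generators -/

section Casimir

local notation "𝔘" => UniversalEnvelopingAlgebra ℂ (𝔤 T n)

variable (n) in
/-- The matrix of generators `𝔼_τ = (ι(E^τ_{ab}))_{a,b}` over `U(𝔤)`. [folklore] -/
def genMatU (τ : T) : Matrix (Fin n) (Fin n) 𝔘 :=
  Matrix.of fun a b ↦ ι ℂ (stdB T n (τ, a, b))

omit [DecidableEq T] in
/-- Entries of the generic matrix `𝔼_τ` over `U(𝔤)`: `(𝔼_τ)_{ab} = ι(E^τ_{ab})`. [folklore] -/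
@[simp]
theorem genMatU_apply (τ : T) (a b : Fin n) : genMatU n τ a b = ι ℂ (stdB T n (τ, a, b)) := rfl

variable (n) in
/-- The **Casimir (Gelfand) elements** `C_{τ,k} = tr(𝔼_τ^k) = ∑ ι(E^τ_{a₁a₂}) ι(E^τ_{a₂a₃}) ⋯ ι(E^τ_{a_k a₁})`
of `U(𝔤𝔩ₙ(ℂ)^T)`. [folklore] -/
def casimir (τ : T) (k : ℕ) : 𝔘 :=
  Matrix.trace (genMatU n τ ^ k)

/-- `(e_{dc} M)_{ab} = δ_{da} M_{cb}` over any semiring. [folklore] -/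
theorem single_one_mul_apply {A : Type*} [Semiring A] (d c a b : Fin n) (M : Matrix (Fin n) (Fin n) A) :
    (Matrix.single d c (1 : A) * M) a b = if d = a then M c b else 0 := by
  by_cases h : d = a
  · subst h; simp
  · simp [Matrix.mul_apply, Matrix.single, h]

/-- `(M e_{dc})_{ab} = δ_{cb} M_{ad}` over any semiring. [folklore] -/
theorem mul_single_one_apply {A : Type*} [Semiring A] (d c a b : Fin n) (M : Matrix (Fin n) (Fin n) A) :
    (M * Matrix.single d c (1 : A)) a b = if c = b then M a d else 0 := by
  by_cases h : c = b
  · subst h; simp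
  · simp [Matrix.mul_apply, Matrix.single, h]

/-- `tr(e_{dc} M) = M_{cd} = tr(M e_{dc})` over any semiring (the matrix `e_{dc}` has central
scalar entries). [folklore] -/
theorem trace_single_one_mul_sub {A : Type*} [Ring A] (d c : Fin n) (M : Matrix (Fin n) (Fin n) A) :
    Matrix.trace (Matrix.single d c (1 : A) * M - M * Matrix.single d c 1) = 0 := by
  rw [Matrix.trace_sub, Matrix.trace, Matrix.trace, Finset.sum_eq_single d, Finset.sum_eq_single c]
  · rw [Matrix.diag_apply, Matrix.diag_apply, single_one_mul_apply, mul_single_one_apply, if_pos rfl,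
      if_pos rfl, sub_self]
  · intro b _ hb; rw [Matrix.diag_apply, mul_single_one_apply, if_neg (Ne.symm hb)]
  · simp
  · intro b _ hb; rw [Matrix.diag_apply, single_one_mul_apply, if_neg (Ne.symm hb)]
  · simp

omit [Fintype T] [DecidableEq T] in
/-- Leibniz rule for the inner derivation `ad(ι x)` on matrices over `U(𝔤)`. [folklore] -/
theorem matrix_map_adU_mul (x : 𝔤 T n) (M N : Matrix (Fin n) (Fin n) 𝔘) :
    (M * N).map (adU (R := ℂ) x) = M.map (adU (R := ℂ) x) * N + M * N.map (adU (R := ℂ) x) := by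
  ext a b
  simp only [Matrix.map_apply, Matrix.mul_apply, Matrix.add_apply, adU_apply,
    ← Finset.sum_add_distrib, map_sum]
  refine Finset.sum_congr rfl fun y _ ↦ ?_
  noncomm_ring

/-- `ad(ι E_l)` on the matrix of generators of block `τ`: the commutator with the scalar matrix
`e_{dc}` if `l = (τ, c, d)` lies in block `τ`, zero otherwise. [folklore] -/
theorem map_adU_genMatU (l : Idx T n) (τ : T) :
    (genMatU n τ).map (adU (R := ℂ) (stdB T n l)) = if l.1 = τ then
      Matrix.single l.2.2 l.2.1 (1 : 𝔘) * genMatU n τ - genMatU n τ * Matrix.single l.2.2 l.2.1 1 else 0 := by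
  obtain ⟨τ', c, d⟩ := l
  ext a b
  rw [Matrix.map_apply, genMatU_apply, adU_apply, ← LieRing.of_associative_ring_bracket, ← LieHom.map_lie,
    lie_stdB]
  dsimp only
  by_cases h : τ' = τ
  · subst h
    rw [if_pos rfl, if_pos rfl, Matrix.sub_apply, single_one_mul_apply, mul_single_one_apply, map_sub]
    congr 1
    · split_ifs <;> simp
    · by_cases hcb : c = b
      · rw [if_pos hcb.symm, if_pos hcb, genMatU_apply]
      · rw [if_neg (Ne.symm hcb), if_neg hcb, map_zero]
  · rw [if_neg h, if_neg h, map_zero, Matrix.zero_apply]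

/-- `ad(ι E_l)` on powers of the matrix of generators. [folklore] -/
theorem map_adU_genMatU_pow (l : Idx T n) (τ : T) (k : ℕ) :
    (genMatU n τ ^ k).map (adU (R := ℂ) (stdB T n l)) = if l.1 = τ then
      Matrix.single l.2.2 l.2.1 (1 : 𝔘) * genMatU n τ ^ k - genMatU n τ ^ k * Matrix.single l.2.2 l.2.1 1
      else 0 := by
  induction k with
  | zero =>
    rw [pow_zero, Matrix.mul_one, Matrix.one_mul, sub_self, ite_self]
    ext a b
    rw [Matrix.map_apply, Matrix.zero_apply, adU_apply, Matrix.one_apply]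
    split_ifs <;> simp
  | succ k ih =>
    rw [pow_succ, matrix_map_adU_mul, ih, map_adU_genMatU]
    split_ifs with h
    · rw [Matrix.sub_mul, Matrix.mul_sub, Matrix.mul_assoc, Matrix.mul_assoc, Matrix.mul_assoc]
      abel
    · rw [Matrix.zero_mul, Matrix.mul_zero, add_zero]

/-- **The Casimir elements commute with the generators.** [folklore] -/
theorem adU_casimir (l : Idx T n) (τ : T) (k : ℕ) : adU (R := ℂ) (stdB T n l) (casimir n τ k) = 0 := by
  rw [casimir, AddMonoidHom.map_trace (adU (R := ℂ) (stdB T n l)), map_adU_genMatU_pow]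
  split_ifs
  · exact trace_single_one_mul_sub _ _ _
  · exact Matrix.trace_zero _ _

omit [DecidableEq T] in
/-- An element of `U(𝔤)` commuting with `ι(𝔤)` is central. [folklore] -/
theorem mem_center_of_forall_ι {u : 𝔘} (h : ∀ x : 𝔤 T n, ι ℂ x * u = u * ι ℂ x) :
    u ∈ Subalgebra.center ℂ 𝔘 := by
  rw [Subalgebra.mem_center_iff]
  intro w
  have hw : w ∈ Submodule.span ℂ (Set.range (word (stdB T n))) := by
    rw [span_word_eq_top]; trivial
  refine Submodule.span_induction ?_ (by simp) (fun a b _ _ ha hb ↦ by rw [add_mul, mul_add, ha, hb])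
    (fun c a _ ha ↦ by rw [smul_mul_assoc, mul_smul_comm, ha]) hw
  rintro _ ⟨lst, rfl⟩
  induction lst with
  | nil => simp
  | cons i lst ih => rw [word_cons, mul_assoc, ih, ← mul_assoc, h, mul_assoc]

/-- **The Casimir elements are central.** [folklore] -/
theorem casimir_mem_center (τ : T) (k : ℕ) : casimir n τ k ∈ Subalgebra.center ℂ 𝔘 := by
  refine mem_center_of_forall_ι fun x ↦ ?_
  have h : adU (R := ℂ) x (casimir n τ k) = 0 := by
    conv_lhs => rw [← (stdB T n).linearCombination_repr x, Finsupp.linearCombination_apply]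
    rw [adU, LinearMap.sub_apply, LinearMap.mulLeft_apply, LinearMap.mulRight_apply, map_finsuppSum,
      Finsupp.sum_mul, Finsupp.mul_sum, ← Finsupp.sum_sub]
    refine Finset.sum_eq_zero fun l _ ↦ ?_
    have := adU_casimir l τ k
    rw [adU_apply] at this
    dsimp only
    rw [map_smul, smul_mul_assoc, mul_smul_comm, ← smul_sub, this, smul_zero]
  rw [adU_apply] at h
  exact sub_eq_zero.mp h

/-- Entries of `𝔼_τ^k` lie in `U_k`. [folklore] -/
theorem genMatU_pow_mem_fil (τ : T) (k : ℕ) (a b : Fin n) : (genMatU n τ ^ k) a b ∈ fil (stdB T n) k := by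
  induction k generalizing a b with
  | zero =>
    rw [pow_zero, Matrix.one_apply]
    split_ifs
    · have h := word_mem_fil_of_length_le (stdB T n) (l := []) (k := 0) le_rfl
      rwa [word_nil] at h
    · exact zero_mem _
  | succ k ih =>
    rw [pow_succ, Matrix.mul_apply]
    exact Submodule.sum_mem _ fun x _ ↦ by
      rw [genMatU_apply]
      exact mul_ι_mem_fil (stdB T n) (ih a x) _

/-- The Casimir element `C_{τ,k}` lies in `U_k`. [folklore] -/
theorem casimir_mem_fil (τ : T) (k : ℕ) : casimir n τ k ∈ fil (stdB T n) k := by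
  rw [casimir, Matrix.trace]
  exact Submodule.sum_mem _ fun a _ ↦ genMatU_pow_mem_fil τ k a a

/-- The symbol of a generator is the corresponding coordinate. [folklore] -/
theorem symb_one_ι_stdB (l : Idx T n) : symb (stdB T n) 1 (ι ℂ (stdB T n l)) = X l := by
  rw [← word_singleton (stdB T n), symb_word (stdB T n) (k := 1) (l := [l]) rfl, Multiset.coe_singleton,
    Multiset.toFinsupp_singleton]
  rfl

/-- **The symbol of `𝔼_τ^k` is `Z_τ^k`** (entrywise), `Z_τ` the generic matrix of coordinates.
[folklore] -/
theorem symb_genMatU_pow (τ : T) (k : ℕ) (a b : Fin n) :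
    symb (stdB T n) k ((genMatU n τ ^ k) a b) = ((genMat τ : Matrix (Fin n) (Fin n) (Coord T n ℂ)) ^ k) a b := by
  induction k generalizing a b with
  | zero =>
    rw [pow_zero, pow_zero, Matrix.one_apply, Matrix.one_apply]
    split_ifs
    · have := symb_word (stdB T n) (k := 0) (l := []) rfl
      rwa [word_nil, Multiset.coe_nil, Multiset.toFinsupp_zero] at this
    · exact map_zero _
  | succ k ih =>
    rw [pow_succ, pow_succ, Matrix.mul_apply, Matrix.mul_apply, map_sum]
    refine Finset.sum_congr rfl fun x _ ↦ ?_
    rw [genMatU_apply, symb_mul (stdB T n) (genMatU_pow_mem_fil τ k a x) (ι_mem_fil_one (stdB T n) _), ih,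
      symb_one_ι_stdB, genMat_apply]

/-- The symbol of the Casimir element `C_{τ,k}` is `tr(Z_τ^k)`. [folklore] -/
theorem symb_casimir (τ : T) (k : ℕ) :
    symb (stdB T n) k (casimir n τ k) = Matrix.trace ((genMat τ : Matrix (Fin n) (Fin n) (Coord T n ℂ)) ^ k) := by
  rw [casimir, Matrix.trace, Matrix.trace, map_sum]
  exact Finset.sum_congr rfl fun a _ ↦ symb_genMatU_pow τ k a a

omit [Fintype T] [DecidableEq T] in
/-- Restricting `tr(Z_τ^k)` to the diagonal gives the power sum `p_k(x_{τ,·})`. [folklore] -/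
theorem restrictDiag_trace_genMat_pow (τ : T) (k : ℕ) :
    restrictDiag T n ℂ (Matrix.trace ((genMat τ : Matrix (Fin n) (Fin n) (Coord T n ℂ)) ^ k)) =
      Literature.RingTheory.MvPolynomial.BlockSymmetric.bpsum ℂ τ k := by
  rw [AddMonoidHom.map_trace (restrictDiag T n ℂ), ← AlgHom.mapMatrix_apply, map_pow]
  have h : (restrictDiag T n ℂ).mapMatrix (genMat (n := n) (K := ℂ) τ) = Matrix.diagonal fun a ↦ X (τ, a) := by
    ext a b
    rw [AlgHom.mapMatrix_apply, Matrix.map_apply, genMat_apply, restrictDiag, aeval_X, Matrix.diagonal_apply]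
  rw [h, Matrix.diagonal_pow, Matrix.trace_diagonal, Literature.RingTheory.MvPolynomial.BlockSymmetric.bpsum, psum, map_sum]
  simp [rename_X]

end Casimir

/-! ### Degree filtration on polynomials; shifts preserve it and act trivially on top components -/

section DegreeFiltration

variable {σ K : Type*} [CommRing K]

/-- Products respect the total-degree filtration. [folklore] -/
theorem mul_mem_restrictTotalDegree {a b : ℕ} {p q : MvPolynomial σ K} (hp : p ∈ restrictTotalDegree σ K a)
    (hq : q ∈ restrictTotalDegree σ K b) : p * q ∈ restrictTotalDegree σ K (a + b) := by
  rw [mem_restrictTotalDegree] at hp hq ⊢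
  exact (totalDegree_mul p q).trans (add_le_add hp hq)

/-- Powers respect the total-degree filtration. [folklore] -/
theorem pow_mem_restrictTotalDegree {a : ℕ} {p : MvPolynomial σ K} (hp : p ∈ restrictTotalDegree σ K a)
    (k : ℕ) : p ^ k ∈ restrictTotalDegree σ K (k * a) := by
  induction k with
  | zero =>
    rw [pow_zero, zero_mul, mem_restrictTotalDegree, totalDegree_one]
  | succ k ih =>
    rw [pow_succ, Nat.succ_mul]
    exact mul_mem_restrictTotalDegree ih hp

/-- The total-degree filtration is increasing. [folklore] -/
theorem restrictTotalDegree_mono {a b : ℕ} (h : a ≤ b) : restrictTotalDegree σ K a ≤ restrictTotalDegree σ K b :=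
  fun _ hp ↦ (mem_restrictTotalDegree _ _ _).mpr (((mem_restrictTotalDegree _ _ _).mp hp).trans h)

/-- Products of powers respect the total-degree filtration. [folklore] -/
theorem prod_pow_mem_restrictTotalDegree {ι : Type*} (F : Finset ι) (g : ι → MvPolynomial σ K) (w m : ι → ℕ)
    (hg : ∀ i ∈ F, g i ∈ restrictTotalDegree σ K (w i)) :
    (∏ i ∈ F, g i ^ m i) ∈ restrictTotalDegree σ K (∑ i ∈ F, m i * w i) := by
  classical
  induction F using Finset.induction_on with
  | empty => rw [Finset.prod_empty, Finset.sum_empty, mem_restrictTotalDegree, totalDegree_one]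
  | insert a F ha ih =>
    rw [Finset.prod_insert ha, Finset.sum_insert ha]
    exact mul_mem_restrictTotalDegree (pow_mem_restrictTotalDegree (hg a (Finset.mem_insert_self a F)) _)
      (ih fun i hi ↦ hg i (Finset.mem_insert_of_mem hi))

/-- Monomials of degree `≤ d` lie in the filtration. [folklore] -/
theorem monomial_mem_restrictTotalDegree {s : σ →₀ ℕ} {d : ℕ} (h : s.degree ≤ d) (r : K) :
    monomial s r ∈ restrictTotalDegree σ K d := by
  rw [mem_restrictTotalDegree]
  exact (totalDegree_monomial_le s r).trans h

/-- Exponents of a polynomial of total degree `≤ d` have degree `≤ d`. [folklore] -/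
theorem degree_le_of_mem_support_of_mem {Q : MvPolynomial σ K} {d : ℕ} (hQ : Q ∈ restrictTotalDegree σ K d)
    {s : σ →₀ ℕ} (hs : s ∈ Q.support) : s.degree ≤ d := by
  have h := (mem_restrictTotalDegree _ _ _).mp hQ
  rw [totalDegree, Finset.sup_le_iff] at h
  exact h s hs

/-- A substitution by polynomials of degree `≤ 1` does not increase the total degree. [folklore] -/
theorem aeval_mem_restrictTotalDegree {τ : Type*} (φ : σ → MvPolynomial τ K)
    (hφ : ∀ i, φ i ∈ restrictTotalDegree τ K 1) {d : ℕ} {Q : MvPolynomial σ K}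
    (hQ : Q ∈ restrictTotalDegree σ K d) : aeval φ Q ∈ restrictTotalDegree τ K d := by
  classical
  rw [← Q.support_sum_monomial_coeff, map_sum]
  refine Submodule.sum_mem _ fun s hs ↦ ?_
  rw [aeval_monomial, algebraMap_eq]
  have hsd : s.degree ≤ d := degree_le_of_mem_support_of_mem hQ hs
  have hprod : (s.prod fun i k ↦ φ i ^ k) ∈ restrictTotalDegree τ K s.degree := by
    have h := prod_pow_mem_restrictTotalDegree s.support φ (fun _ ↦ 1) s fun i _ ↦ hφ i
    simp only [mul_one] at h
    exact h
  have := mul_mem_restrictTotalDegree ((mem_restrictTotalDegree _ _ _).mpr (totalDegree_C (σ := τ) (coeff s Q)).le)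
    (restrictTotalDegree_mono hsd hprod)
  rwa [zero_add] at this

/-- Variables have total degree `≤ 1`. [folklore] -/
theorem X_mem_restrictTotalDegree (i : σ) : (X i : MvPolynomial σ K) ∈ restrictTotalDegree σ K 1 := by
  rw [X]
  exact monomial_mem_restrictTotalDegree (by rw [Finsupp.degree_single]) 1

/-- Constants lie in every step of the total-degree filtration. [folklore] -/
theorem C_mem_restrictTotalDegree (c : K) (d : ℕ) : (C c : MvPolynomial σ K) ∈ restrictTotalDegree σ K d := by
  rw [mem_restrictTotalDegree, totalDegree_C]
  exact Nat.zero_le _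

/-- `X i - C c` has total degree `≤ 1`. [folklore] -/
theorem X_sub_C_mem_restrictTotalDegree (i : σ) (c : K) :
    (X i - C c : MvPolynomial σ K) ∈ restrictTotalDegree σ K 1 :=
  sub_mem (X_mem_restrictTotalDegree i) (C_mem_restrictTotalDegree c 1)

/-- `(z_i - c)^k ≡ z_i^k` modulo degree `≤ k - 1` (`k ≥ 1`). [folklore] -/
theorem X_sub_C_pow_sub_X_pow_mem (i : σ) (c : K) {k : ℕ} (hk : 1 ≤ k) :
    (X i - C c) ^ k - X i ^ k ∈ restrictTotalDegree σ K (k - 1) := by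
  induction k, hk using Nat.le_induction with
  | base =>
    rw [pow_one, pow_one, sub_sub_cancel_left, mem_restrictTotalDegree, totalDegree_neg, totalDegree_C]
  | succ k hk ih =>
    have e : (X i - C c) ^ (k + 1) - X i ^ (k + 1) =
        ((X i - C c) ^ k - X i ^ k) * (X i - C c) - X i ^ k * C c := by ring
    rw [e, show k + 1 - 1 = (k - 1) + 1 by omega]
    refine sub_mem (mul_mem_restrictTotalDegree ih (X_sub_C_mem_restrictTotalDegree i c)) ?_
    have h := mul_mem_restrictTotalDegree (pow_mem_restrictTotalDegree (X_mem_restrictTotalDegree (K := K) i) k)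
      (C_mem_restrictTotalDegree (σ := σ) c 0)
    rw [mul_one, add_zero] at h
    exact restrictTotalDegree_mono (by omega) h

/-- **Shifts are the identity modulo lower degree**: for `Q` of total degree `≤ d + 1`,
`Q(x - c) - Q(x)` has total degree `≤ d`. [folklore] -/
theorem shiftPoly_sub_mem (c : σ → K) {d : ℕ} {Q : MvPolynomial σ K}
    (hQ : Q ∈ restrictTotalDegree σ K (d + 1)) : shiftPoly c Q - Q ∈ restrictTotalDegree σ K d := by
  classical
  -- reduce to monomials
  suffices key : ∀ s : σ →₀ ℕ, shiftPoly c (monomial s 1) - monomial s 1 ∈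
      restrictTotalDegree σ K (s.degree - 1) by
    rw [← Q.support_sum_monomial_coeff, map_sum, ← Finset.sum_sub_distrib]
    refine Submodule.sum_mem _ fun s hs ↦ ?_
    have hsd := degree_le_of_mem_support_of_mem hQ hs
    rw [← mul_one (coeff s Q), ← smul_eq_mul, ← smul_monomial, map_smul, ← smul_sub]
    exact Submodule.smul_mem _ _ (restrictTotalDegree_mono (by omega) (key s))
  have hX : ∀ (i : σ) (k : ℕ), shiftPoly c (monomial (Finsupp.single i k) 1) = (X i - C (c i)) ^ k := by
    intro i k
    rw [← X_pow_eq_monomial, map_pow, shiftPoly, aeval_X]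
  intro s
  induction s using Finsupp.induction with
  | zero =>
    have h1 : (monomial (0 : σ →₀ ℕ) (1 : K)) = 1 := rfl
    rw [h1, map_one, sub_self]
    exact zero_mem _
  | single_add i k s hi hk ih =>
    have hk1 : 1 ≤ k := Nat.one_le_iff_ne_zero.mpr hk
    have hdeg : (Finsupp.single i k + s).degree = k + s.degree := by
      rw [map_add, Finsupp.degree_single]
    have hsplit : monomial (Finsupp.single i k + s) (1 : K) = monomial (Finsupp.single i k) 1 * monomial s 1 := by
      rw [monomial_mul, one_mul]
    rw [hdeg, hsplit, map_mul, hX]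
    by_cases hs0 : s = 0
    · subst hs0
      have h1 : (monomial (0 : σ →₀ ℕ) (1 : K)) = 1 := rfl
      rw [h1, map_one, mul_one, mul_one, map_zero, add_zero, ← X_pow_eq_monomial]
      exact X_sub_C_pow_sub_X_pow_mem i (c i) hk1
    · have hsd : 1 ≤ s.degree := by
        rw [Nat.one_le_iff_ne_zero, Ne, Finsupp.degree_eq_zero_iff]
        exact hs0
      have e : (X i - C (c i)) ^ k * shiftPoly c (monomial s 1) - monomial (Finsupp.single i k) 1 * monomial s 1 =
          (X i - C (c i)) ^ k * (shiftPoly c (monomial s 1) - monomial s 1) +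
            ((X i - C (c i)) ^ k - X i ^ k) * monomial s 1 := by
        rw [← X_pow_eq_monomial]; ring
      rw [e]
      refine add_mem ?_ ?_
      · have h := mul_mem_restrictTotalDegree
          (pow_mem_restrictTotalDegree (X_sub_C_mem_restrictTotalDegree (K := K) i (c i)) k) ih
        rw [mul_one] at h
        exact restrictTotalDegree_mono (by omega) h
      · have h := mul_mem_restrictTotalDegree (X_sub_C_pow_sub_X_pow_mem i (c i) hk1)
          (monomial_mem_restrictTotalDegree (le_refl s.degree) (1 : K))
        exact restrictTotalDegree_mono (by omega) h

/-- **Shifts preserve the total degree and the top homogeneous component.** [folklore] -/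
theorem totalDegree_shiftPoly_le_and_homogeneousComponent_eq (c : σ → K) {d : ℕ} {Q : MvPolynomial σ K}
    (hQ : Q.totalDegree ≤ d) :
    (shiftPoly c Q).totalDegree ≤ d ∧ homogeneousComponent d (shiftPoly c Q) = homogeneousComponent d Q := by
  rcases Nat.eq_zero_or_pos d with rfl | hd
  · have hQ' : Q = C (coeff 0 Q) := totalDegree_eq_zero_iff_eq_C.mp (Nat.le_zero.mp hQ)
    rw [hQ', shiftPoly, aeval_C, algebraMap_eq]
    exact ⟨(totalDegree_C _).le, rfl⟩
  · obtain ⟨d, rfl⟩ := Nat.exists_eq_add_one_of_ne_zero hd.ne'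
    have h := shiftPoly_sub_mem c ((mem_restrictTotalDegree _ _ _).mpr hQ)
    have hR := (mem_restrictTotalDegree _ _ _).mp h
    constructor
    · have := totalDegree_add (shiftPoly c Q - Q) Q
      rw [sub_add_cancel] at this
      exact this.trans (max_le (hR.trans (Nat.le_succ d)) hQ)
    · have := homogeneousComponent_eq_zero _ _ (lt_of_le_of_lt hR (Nat.lt_succ_self d))
      rw [map_sub, sub_eq_zero] at this
      exact this

end DegreeFiltration

/-! ### Central elements with prescribed restricted top symbol -/

section Lifts

local notation "𝔘" => UniversalEnvelopingAlgebra ℂ (𝔤 T n)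

/-- Symbols of powers. [cite: Humphreys1972, §17.3] -/
theorem pow_mem_fil_and_symb_pow {u : 𝔘} {w : ℕ} (hu : u ∈ fil (stdB T n) w) (m : ℕ) :
    u ^ m ∈ fil (stdB T n) (m * w) ∧ symb (stdB T n) (m * w) (u ^ m) = symb (stdB T n) w u ^ m := by
  induction m with
  | zero =>
    rw [pow_zero, pow_zero, zero_mul]
    refine ⟨?_, ?_⟩
    · have h := word_mem_fil_of_length_le (stdB T n) (l := []) (k := 0) le_rfl
      rwa [word_nil] at h
    · have := symb_word (stdB T n) (k := 0) (l := []) rfl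
      rwa [word_nil, Multiset.coe_nil, Multiset.toFinsupp_zero] at this
  | succ m ih =>
    rw [pow_succ, pow_succ, Nat.succ_mul]
    exact ⟨mul_mem_fil (stdB T n) ih.1 hu, by rw [symb_mul (stdB T n) ih.1 hu, ih.2]⟩

variable (T n) in
/-- The Casimir element of block `τ` and degree `k + 1` as an element of the centre. [folklore] -/
def casimirC (p : T × Fin n) : Subalgebra.center ℂ 𝔘 :=
  ⟨casimir n p.1 (p.2 + 1), casimir_mem_center p.1 _⟩

variable (T n) in
/-- The algebra map `G ↦ G(C_{τ,k+1})` from polynomials in the variables `Y_{τ,k}` to the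
centre. [folklore] -/
def zOfPoly : MvPolynomial (T × Fin n) ℂ →ₐ[ℂ] Subalgebra.center ℂ 𝔘 :=
  MvPolynomial.aeval (casimirC T n)

/-- For a monomial `Y^m` of weight `w(m) = ∑ m_{τ,k} (k+1)`: `∏ C_{τ,k+1}^{m_{τ,k}}` lies in
`U_{w(m)}` and its `w(m)`-th symbol restricts to `∏ p_{k+1}(x_{τ,·})^{m_{τ,k}}`. [folklore] -/
theorem zOfPoly_monomial (m : T × Fin n →₀ ℕ) :
    (zOfPoly T n (monomial m 1) : 𝔘) ∈ fil (stdB T n) (Finsupp.weight (Literature.RingTheory.MvPolynomial.BlockSymmetric.blockWeight T n) m) ∧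
      restrictDiag T n ℂ (symb (stdB T n) (Finsupp.weight (Literature.RingTheory.MvPolynomial.BlockSymmetric.blockWeight T n) m)
        (zOfPoly T n (monomial m 1) : 𝔘)) = Literature.RingTheory.MvPolynomial.BlockSymmetric.blockPsumAeval T n ℂ (monomial m 1) := by
  induction m using Finsupp.induction with
  | zero =>
    have h1 : (monomial (0 : T × Fin n →₀ ℕ) (1 : ℂ)) = 1 := rfl
    rw [h1, map_one, map_one, OneMemClass.coe_one, map_zero]
    refine ⟨?_, ?_⟩
    · have h := word_mem_fil_of_length_le (stdB T n) (l := []) (k := 0) le_rfl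
      rwa [word_nil] at h
    · have := symb_word (stdB T n) (k := 0) (l := []) rfl
      rw [word_nil, Multiset.coe_nil, Multiset.toFinsupp_zero] at this
      rw [this]
      exact map_one _
  | single_add p k m hp hk ih =>
    have hsplit : monomial (Finsupp.single p k + m) (1 : ℂ) = X p ^ k * monomial m 1 := by
      rw [X_pow_eq_monomial, monomial_mul, one_mul]
    have hw : Finsupp.weight (Literature.RingTheory.MvPolynomial.BlockSymmetric.blockWeight T n) (Finsupp.single p k + m) =
        k * (p.2 + 1) + Finsupp.weight (Literature.RingTheory.MvPolynomial.BlockSymmetric.blockWeight T n) m := by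
      rw [map_add, Finsupp.weight_single, smul_eq_mul]
      rfl
    have hXp : zOfPoly T n (X p) = casimirC T n p := aeval_X _ _
    have hcoe : ((casimirC T n p : Subalgebra.center ℂ 𝔘) : 𝔘) = casimir n p.1 (p.2 + 1) := rfl
    rw [hsplit, hw, map_mul, map_pow, map_mul, map_pow, hXp, Subalgebra.coe_mul, SubmonoidClass.coe_pow, hcoe]
    have hC := pow_mem_fil_and_symb_pow (casimir_mem_fil (n := n) p.1 (p.2 + 1)) k
    refine ⟨mul_mem_fil (stdB T n) hC.1 ih.1, ?_⟩
    have hXp' : Literature.RingTheory.MvPolynomial.BlockSymmetric.blockPsumAeval T n ℂ (X p) = Literature.RingTheory.MvPolynomial.BlockSymmetric.bpsum ℂ p.1 (p.2 + 1) := aeval_X _ _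
    rw [symb_mul (stdB T n) hC.1 ih.1, map_mul, ih.2, hC.2, map_pow, hXp']
    congr 2
    show restrictDiag T n ℂ (symb (stdB T n) (p.2 + 1) (casimir n p.1 (p.2 + 1))) = _
    rw [symb_casimir, restrictDiag_trace_genMat_pow]

/-- **Central elements with prescribed restricted top symbol**: for `G` weighted homogeneous of
weight `d`, the central element `G(C_{τ,k+1})` lies in `U_d` and its `d`-th symbol restricts on
the diagonal to `G(p_{k+1}(x_{τ,·}))`. (Replaces Bourbaki's symmetrisation step, LIE VIII §8.5 proof
of Th. 2 (b), for `𝔤𝔩ₙ`.) [cite: Humphreys1972, §23.3] -/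
theorem exists_center_lift {G : MvPolynomial (T × Fin n) ℂ} {d : ℕ}
    (hG : IsWeightedHomogeneous (Literature.RingTheory.MvPolynomial.BlockSymmetric.blockWeight T n) G d) :
    ∃ z : 𝔘, z ∈ Subalgebra.center ℂ 𝔘 ∧ z ∈ fil (stdB T n) d ∧
      restrictDiag T n ℂ (symb (stdB T n) d z) = Literature.RingTheory.MvPolynomial.BlockSymmetric.blockPsumAeval T n ℂ G := by
  classical
  refine ⟨zOfPoly T n G, (zOfPoly T n G).2, ?_, ?_⟩
  · have hG' : (zOfPoly T n G : 𝔘) = ∑ m ∈ G.support, coeff m G • (zOfPoly T n (monomial m 1) : 𝔘) := by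
      conv_lhs => rw [← G.support_sum_monomial_coeff, map_sum]
      rw [AddSubmonoidClass.coe_finsetSum]
      refine Finset.sum_congr rfl fun m _ ↦ ?_
      rw [show monomial m (coeff m G) = coeff m G • monomial m 1 by rw [smul_monomial, smul_eq_mul, mul_one],
        map_smul, Subalgebra.coe_smul]
    rw [hG']
    refine Submodule.sum_mem _ fun m hm ↦ Submodule.smul_mem _ _ ?_
    rw [← hG (mem_support_iff.mp hm)]
    exact (zOfPoly_monomial m).1
  · have hG' : (zOfPoly T n G : 𝔘) = ∑ m ∈ G.support, coeff m G • (zOfPoly T n (monomial m 1) : 𝔘) := by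
      conv_lhs => rw [← G.support_sum_monomial_coeff, map_sum]
      rw [AddSubmonoidClass.coe_finsetSum]
      refine Finset.sum_congr rfl fun m _ ↦ ?_
      rw [show monomial m (coeff m G) = coeff m G • monomial m 1 by rw [smul_monomial, smul_eq_mul, mul_one],
        map_smul, Subalgebra.coe_smul]
    rw [hG', map_sum, map_sum]
    conv_rhs => rw [← G.support_sum_monomial_coeff, map_sum]
    refine Finset.sum_congr rfl fun m hm ↦ ?_
    rw [map_smul, map_smul, ← hG (mem_support_iff.mp hm), (zOfPoly_monomial m).2,
      show monomial m (coeff m G) = coeff m G • monomial m 1 by rw [smul_monomial, smul_eq_mul, mul_one], map_smul]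

end Lifts

/-! ### Surjectivity onto the block-symmetric polynomials, and the main theorem -/

section Main

local notation "𝔘" => UniversalEnvelopingAlgebra ℂ (𝔤 T n)

open Literature.RingTheory.MvPolynomial.BlockSymmetric

/-- If a polynomial of total degree `≤ d + 1` has vanishing `(d+1)`-st homogeneous component, its
total degree is `≤ d`. [folklore] -/
theorem totalDegree_le_of_homogeneousComponent_eq_zero {σ K : Type*} [CommRing K] {Q : MvPolynomial σ K}
    {d : ℕ} (hQ : Q.totalDegree ≤ d + 1) (h0 : homogeneousComponent (d + 1) Q = 0) : Q.totalDegree ≤ d := by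
  classical
  rw [totalDegree, Finset.sup_le_iff]
  intro s hs
  have h1 : s.degree ≤ d + 1 := by
    have := le_totalDegree hs
    rw [totalDegree] at hQ
    exact (Finset.le_sup (f := fun s : σ →₀ ℕ ↦ s.sum fun _ e ↦ e) hs).trans hQ
  have h2 : s.degree ≠ d + 1 := fun h ↦ by
    have := congrArg (coeff s) h0
    rw [coeff_homogeneousComponent, if_pos h, coeff_zero] at this
    exact (mem_support_iff.mp hs) this
  show (s.sum fun _ e ↦ e) ≤ d
  have : s.degree ≤ d := by omega
  exact this

/-- The total degree of the Harish-Chandra projection of an element of `U_d` is `≤ d`. [folklore] -/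
theorem totalDegree_hcProj_le {z : 𝔘} {d : ℕ} (hz : z ∈ fil (stdB T n) d) : (hcProj T n z).totalDegree ≤ d := by
  rw [hcProj_apply, ← mem_restrictTotalDegree]
  refine aeval_mem_restrictTotalDegree _ (fun l ↦ ?_)
    ((mem_restrictTotalDegree _ _ _).mpr (totalDegree_symbAll_le _ hz))
  split_ifs
  · exact X_mem_restrictTotalDegree _
  · exact zero_mem _

/-- The `γ'`-image of the central lift of a weighted homogeneous `G` of weight `d`: total degree
`≤ d` and top homogeneous component `G(p_{k+1}(x_{τ,·}))`. [folklore] -/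
theorem exists_gamma_top {c : T × Fin n → ℂ}
    {γ' : Subalgebra.center ℂ 𝔘 →ₐ[ℂ] MvPolynomial (T × Fin n) ℂ} (hγ : HasHWProperty c γ')
    {G : MvPolynomial (T × Fin n) ℂ} {d : ℕ} (hG : IsWeightedHomogeneous (blockWeight T n) G d) :
    ∃ z : Subalgebra.center ℂ 𝔘, (γ' z).totalDegree ≤ d ∧ homogeneousComponent d (γ' z) = blockPsumAeval T n ℂ G := by
  obtain ⟨z, hzc, hzf, hzs⟩ := exists_center_lift hG
  refine ⟨⟨z, hzc⟩, ?_⟩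
  rw [eq_shiftPoly_hcProj hγ]
  have h := totalDegree_shiftPoly_le_and_homogeneousComponent_eq c (totalDegree_hcProj_le hzf)
  refine ⟨h.1, ?_⟩
  rw [h.2]
  show homogeneousComponent d (hcProj T n z) = _
  rw [homogeneousComponent_hcProj, hzs]

/-- **Surjectivity onto the block-symmetric polynomials**: if `γ'` has the highest weight
property and takes block-symmetric values, every block-symmetric polynomial is in its range
(induction on the degree: peel off the top homogeneous component with a central lift, using the
graded fundamental theorem of block-symmetric polynomials in power-sum form).
[cite: KnappVogan1995, Thm. 4.95 (onto); Humphreys1972, §23.3] -/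
theorem exists_eq_gamma_of_mem {c : T × Fin n → ℂ}
    {γ' : Subalgebra.center ℂ 𝔘 →ₐ[ℂ] MvPolynomial (T × Fin n) ℂ} (hγ : HasHWProperty c γ')
    (hsym : ∀ z, γ' z ∈ blockSymmetricSubalgebra T n ℂ) (d : ℕ) :
    ∀ f ∈ blockSymmetricSubalgebra T n ℂ, f.totalDegree ≤ d → ∃ z, γ' z = f := by
  induction d with
  | zero =>
    intro f hf hd
    obtain ⟨G, hG, hGf⟩ := exists_isWeightedHomogeneous_blockPsumAeval_eq T n hf
      ((totalDegree_zero_iff_isHomogeneous _).mp (Nat.le_zero.mp hd))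
    obtain ⟨z, hz1, hz2⟩ := exists_gamma_top hγ hG
    refine ⟨z, ?_⟩
    rw [← homogeneousComponent_eq_self ((totalDegree_zero_iff_isHomogeneous _).mp (Nat.le_zero.mp hz1)), hz2, hGf]
  | succ d ih =>
    intro f hf hd
    have hfd := homogeneousComponent_mem_blockSymmetricSubalgebra hf (d + 1)
    obtain ⟨G, hG, hGf⟩ := exists_isWeightedHomogeneous_blockPsumAeval_eq T n hfd
      (homogeneousComponent_isHomogeneous (d + 1) f)
    obtain ⟨z, hz1, hz2⟩ := exists_gamma_top hγ hG
    have hg : f - γ' z ∈ blockSymmetricSubalgebra T n ℂ := Subalgebra.sub_mem _ hf (hsym z)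
    have hgd : (f - γ' z).totalDegree ≤ d := by
      refine totalDegree_le_of_homogeneousComponent_eq_zero ?_ ?_
      · exact (totalDegree_sub _ _).trans (max_le hd hz1)
      · rw [map_sub, hz2, hGf, sub_self]
    obtain ⟨z', hz'⟩ := ih _ hg hgd
    refine ⟨z' + z, ?_⟩
    rw [map_add, hz', sub_add_cancel]

/-- **Harish-Chandra's theorem for `𝔤𝔩ₙ(ℂ)^T` (complex core, highest-weight form).** Let
`γ' : Z(U(𝔤𝔩ₙ(ℂ)^T)) → ℂ[x_{τ,i}]` be an algebra homomorphism such that every central element `z`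
acts on every highest weight vector of weight `λ` (in every module in `Type`) by `γ'(z)(λ + c)`
(`c` a fixed shift; for the Harish-Chandra homomorphism `c = ρ`), and whose values are
block-symmetric (`W`-invariant). Then `γ'` is injective and its range is exactly the
block-symmetric polynomials `ℂ[x_{τ,i}]^{𝔖ₙ^T} = S(𝔥)^W`.
This is "`γ : Z(𝔤) → ℋ^W` is an algebra isomorphism" (Knapp–Vogan 1995, Thm. 4.95; Knapp 2002,
Thm. 5.44; Bourbaki LIE VIII §8.5 Th. 2; Humphreys 1972, §23.3) for `𝔤 = 𝔤𝔩ₙ(ℂ)^T`, with `γ`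
characterised by highest weights (Knapp–Vogan (4.99)). Proof: PBW (`PoincareBirkhoffWitt`),
the Harish-Chandra projection and its highest weight property (`lift_center_hw`), Zariski density of
dominant weights (`HighestWeightGL`) force `γ' = (hcProj)(x - c)`; injectivity by top symbols and
Chevalley restriction (`ChevalleyRestrictionGL`); surjectivity by the Casimir elements `tr(𝔼_τ^k)`
and the graded fundamental theorem of block-symmetric polynomials (`BlockSymmetric`).
[cite: KnappVogan1995, Thm. 4.95 with (4.99)] -/
theorem injective_and_range_eq_of_hasHWProperty {c : T × Fin n → ℂ}
    {γ' : Subalgebra.center ℂ 𝔘 →ₐ[ℂ] MvPolynomial (T × Fin n) ℂ} (hγ : HasHWProperty c γ')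
    (hsym : ∀ z, γ' z ∈ blockSymmetricSubalgebra T n ℂ) :
    Function.Injective γ' ∧ γ'.range = blockSymmetricSubalgebra T n ℂ := by
  refine ⟨injective_of_hasHWProperty hγ, le_antisymm ?_ fun f hf ↦ ?_⟩
  · rintro _ ⟨z, rfl⟩
    exact hsym z
  · obtain ⟨z, hz⟩ := exists_eq_gamma_of_mem hγ hsym f.totalDegree f hf le_rfl
    exact ⟨z, hz⟩

end Main

end Literature.NumberTheory.Automorphic.HCCore
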